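import Summits.AtomisticToContinuum.Crystallization.Theorems.PricedLinkCensusLocalToGlobalThomsonPotential

/-!
# Thomson's inequality in `ℝ⁸` for `L²` fields with prescribed weak divergence

Route `PricedLinkCensus`, crux `LocalToGlobal` (stmt-AtomisticToContinuum-14232), line
`flux-cell-joint-census`, support for the registered stub `stub_confinedThomson : ConfinedThomson`.
For the regularised potential `v = farPotential t ρ = ∫ ρ(z) f_t(· - z) dz` of a bounded density `ρ`
vanishing off `B̄(0,R₀)` (`PricedLinkCensusLocalToGlobalThomsonPotential`) we rewrite its Dirichlet energy
`∫‖∇v‖² = -∫ Δv · v` as a double integral against the self-convolution kernel of the regularisation: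

  `-∫ Δv · v = -∫ ρ(z) ∫ ρ(w) m_t(z - w) dw dz`,  `m_t(y) = ∫ Δf_t(x) f_t(y + x) dx`
  (`integral_laplacian_mul_farPotential`; two Fubini exchanges of bounded, boundedly supported integrands
  on `ℝ⁸ × ℝ⁸` and one translation),

and record the properties of `m_t = farSelfKernel t` needed for the limit `t → 0`: continuity, the uniform
bound `|m_t| ≤ 64 t⁻⁶ ∫|Δf₁|`, the exact value `m_t(y) = -2π⁴‖y‖⁻⁶` for `‖y‖ ≥ 3t`
(`PricedLinkCensusLocalToGlobalThomsonKernelBounds`), whence `|m_t(y)| ≤ C ‖y‖⁻⁶` with `C` independent of `t`.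

Then **THOMSON'S INEQUALITY** (`coulomb_double_integral_le_of_weakDiv`): for a bounded integrable density `ρ`
on `ℝ⁸` vanishing off a ball and `F ∈ L²(ℝ⁸; ℝ⁸)` with weak divergence `ρ` (`∫ ⟪F, ∇φ⟫ = -∫ ρ φ` for all
`φ ∈ C¹_c`), the Coulomb-type double integral is dominated by the field energy,

  `∫ ρ(x) ∫ ρ(z) ‖x - z‖⁻⁶ dz dx ≤ 2π⁴ ∫ ‖F‖²`

(Thomson's / Dirichlet's principle, `‖z‖⁻⁶/(2π⁴)` being the Newton kernel of `ℝ⁸`): `∫ρ v_t = -∫⟪F, ∇v_t⟫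
≤ ‖F‖₂ ‖∇v_t‖₂` (cut-off removal, Cauchy–Schwarz), `‖∇v_t‖₂² = -∫ρ∫ρ m_t`, and as `t → 0` along `tₙ = 1/(n+1)`,
`∫ρ v_t → S`, `-∫ρ∫ρ m_t → 2π⁴ S` (kernel exchange), whence `S² ≤ 2π⁴ S ‖F‖₂²`.

References: W. Thomson (Lord Kelvin) 1848; E. H. Lieb, M. Loss, *Analysis* (2001), Thm 9.8 (positivity of
the Coulomb energy via regularisation), §11.15 (Thomson's principle), §5.4 (Fubini for convolutions);
O. D. Kellogg, *Foundations of Potential Theory* (1929/1967), Ch. XI §11.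
-/

noncomputable section

open MeasureTheory Set Filter Metric Topology InnerProductSpace Function
open scoped RealInnerProductSpace Laplacian ContDiff

namespace Summit.AtomisticToContinuum.Crystallization.Theorems.PricedLinkCensusLocalToGlobal

/-! ### Bounded integrands with bounded support on `ℝ⁸ × ℝ⁸` are integrable -/

/-- A strongly measurable function on `ℝ⁸ × ℝ⁸`, bounded and vanishing off a product of closed balls, is
integrable for the product Lebesgue measure. [folklore] -/
theorem integrable_prod_of_bdd_support {G : E8 × E8 → ℝ} (hG : AEStronglyMeasurable G (volume.prod volume))
    {K a b : ℝ} (hK : ∀ p, |G p| ≤ K) (h0 : ∀ p, G p ≠ 0 → p.1 ∈ closedBall (0 : E8) a ∧ p.2 ∈ closedBall (0 : E8) b) :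
    Integrable G (volume.prod volume) := by
  set S : Set (E8 × E8) := closedBall (0 : E8) a ×ˢ closedBall (0 : E8) b with hS
  have hSm : MeasurableSet S := measurableSet_closedBall.prod measurableSet_closedBall
  have hSfin : (volume.prod volume) S ≠ ⊤ := by
    rw [hS, Measure.prod_prod]
    exact ENNReal.mul_ne_top measure_closedBall_lt_top.ne measure_closedBall_lt_top.ne
  have hint : Integrable (S.indicator fun _ => K) (volume.prod volume) :=
    (integrable_indicator_iff hSm).2 (integrableOn_const hSfin)
  refine hint.mono' hG (Eventually.of_forall fun p => ?_)
  by_cases hp : G p = 0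
  · rw [hp, norm_zero]
    exact indicator_nonneg (fun _ _ => (abs_nonneg _).trans (hK p)) _
  · rw [indicator_of_mem (show p ∈ S from mk_mem_prod (h0 p hp).1 (h0 p hp).2), Real.norm_eq_abs]
    exact hK p

/-! ### The self-convolution kernel `m_t = (Δ f_t) ⋆ f_t` -/

variable {t : ℝ}

/-- Reflected form: `m_t(y) = ∫ Δf_t(-x) f_t(y - x) dx` (substitute `x ↦ -x`). [folklore] -/
theorem farSelfKernel_eq_integral_sub (t : ℝ) (y : E8) :
    farSelfKernel t y = ∫ x, (Δ (newtonFar8 t)) (-x) * newtonFar8 t (y - x) := by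
  rw [farSelfKernel]
  have h := integral_neg_eq_self (fun x => (Δ (newtonFar8 t)) (-x) * newtonFar8 t (y - x)) volume
  simp only [neg_neg, sub_neg_eq_add] at h
  exact h

/-- `m_t` is continuous. [folklore] -/
theorem continuous_farSelfKernel (ht : 0 < t) : Continuous (farSelfKernel t) := by
  have hk : Integrable fun x : E8 => (Δ (newtonFar8 t)) (-x) := (integrable_laplacian_newtonFar8 ht).comp_neg
  have hk0 : ∀ x : E8, 2 * t < ‖x‖ → (Δ (newtonFar8 t)) (-x) = 0 := fun x hx =>
    laplacian_newtonFar8_eq_zero_of_le ht (by rw [norm_neg]; exact hx.le)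
  have h := Literature.Analysis.FluidPDE.continuous_integral_smul_comp_sub hk hk0
    (contDiff_newtonFar8 ht (n := 0)).continuous
  rw [show farSelfKernel t = fun y => ∫ x, (Δ (newtonFar8 t)) (-x) * newtonFar8 t (y - x) from
    funext (farSelfKernel_eq_integral_sub t)]
  exact h

/-- Uniform bound `|m_t(y)| ≤ 64 t⁻⁶ ∫|Δf₁|`. [folklore] -/
theorem abs_farSelfKernel_le (ht : 0 < t) (y : E8) :
    |farSelfKernel t y| ≤ 64 * (t ^ 6)⁻¹ * ∫ z, |(Δ (newtonFar8 1)) z| :=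
  abs_integral_laplacian_newtonFar8_mul_le ht y

/-- Exact value off the core: `m_t(y) = -2π⁴ ‖y‖⁻⁶` for `‖y‖ ≥ 3t`. [cite: GilbargTrudinger2001, Thm 2.1] -/
theorem farSelfKernel_eq_of_le (ht : 0 < t) {y : E8} (hy : 3 * t ≤ ‖y‖) :
    farSelfKernel t y = -(2 * Real.pi ^ 4) * ‖y‖⁻¹ ^ 6 :=
  integral_laplacian_newtonFar8_mul_newtonFar8 ht hy

/-- **Kernel domination, uniformly in `t`**: `|m_t(y)| ≤ C₈ ‖y‖⁻⁶` for all `y ≠ 0`, `0 < t`, with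
`C₈ = max (2π⁴) (46656 ∫|Δf₁|)` (`46656 = 64·3⁶`; inside `‖y‖ < 3t` use the uniform bound and
`t⁻⁶ ≤ 3⁶‖y‖⁻⁶`, outside the exact value). [folklore] -/
theorem abs_farSelfKernel_le_kernel (ht : 0 < t) {y : E8} (hy : y ≠ 0) :
    |farSelfKernel t y| ≤ max (2 * Real.pi ^ 4) (46656 * ∫ z, |(Δ (newtonFar8 1)) z|) * ‖y‖⁻¹ ^ 6 := by
  have hy0 : 0 < ‖y‖ := norm_pos_iff.2 hy
  rcases le_or_gt (3 * t) ‖y‖ with h | h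
  · rw [farSelfKernel_eq_of_le ht h, abs_mul, abs_neg, abs_of_pos (by positivity),
      abs_of_nonneg (by positivity)]
    exact mul_le_mul_of_nonneg_right (le_max_left _ _) (by positivity)
  · have hL := integral_abs_laplacian_newtonFar8_nonneg
    refine (abs_farSelfKernel_le ht y).trans ?_
    have h1 : (t ^ 6)⁻¹ ≤ 729 * ‖y‖⁻¹ ^ 6 := by
      rw [inv_pow, show (729 : ℝ) * (‖y‖ ^ 6)⁻¹ = ((‖y‖ / 3) ^ 6)⁻¹ by rw [div_pow]; norm_num; field_simp]
      exact inv_anti₀ (by positivity) (pow_le_pow_left₀ (by positivity) (by linarith) 6)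
    calc 64 * (t ^ 6)⁻¹ * ∫ z, |(Δ (newtonFar8 1)) z| ≤ 64 * (729 * ‖y‖⁻¹ ^ 6) * ∫ z, |(Δ (newtonFar8 1)) z| := by
          gcongr
      _ = (46656 * ∫ z, |(Δ (newtonFar8 1)) z|) * ‖y‖⁻¹ ^ 6 := by ring
      _ ≤ _ := mul_le_mul_of_nonneg_right (le_max_right _ _) (by positivity)

/-- The domination constant is nonnegative. [folklore] -/
theorem farSelfKernel_const_nonneg : 0 ≤ max (2 * Real.pi ^ 4) (46656 * ∫ z, |(Δ (newtonFar8 1)) z|) :=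
  le_max_of_le_left (by positivity)

/-! ### The energy of the potential as a double integral -/

variable {ρ : E8 → ℝ} {M R₀ : ℝ}

/-- Translation: `∫ Δf_t(x - z) f_t(x - w) dx = m_t(z - w)`. [folklore] -/
theorem integral_laplacian_sub_mul_sub (t : ℝ) (z w : E8) :
    ∫ x, (Δ (newtonFar8 t)) (x - z) * newtonFar8 t (x - w) = farSelfKernel t (z - w) := by
  rw [farSelfKernel]
  have h := integral_add_right_eq_self (μ := (volume : Measure E8))
    (fun x => (Δ (newtonFar8 t)) (x - z) * newtonFar8 t (x - w)) z
  simp only [add_sub_cancel_right] at h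
  rw [← h]
  refine integral_congr_ae (Eventually.of_forall fun x => ?_)
  simp only
  rw [show x + z - w = z - w + x by abel]

/-- **The Dirichlet energy of the regularised potential as a double integral**:
`∫ Δv(x) v(x) dx = ∫ ρ(z) ∫ ρ(w) m_t(z - w) dw dz` for `v = farPotential t ρ`. [cite: LiebLoss2001, Thm 9.8] -/
theorem integral_laplacian_mul_farPotential (ht : 0 < t) (hρi : Integrable ρ) (hρb : ∀ z, |ρ z| ≤ M)
    (hρ0 : ∀ z, R₀ < ‖z‖ → ρ z = 0) (hR₀ : 0 ≤ R₀) :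
    ∫ x, (Δ (farPotential t ρ)) x * farPotential t ρ x = ∫ z, ρ z * ∫ w, ρ w * farSelfKernel t (z - w) := by
  have hM : 0 ≤ M := (abs_nonneg _).trans (hρb 0)
  have hρR : ∀ z, ρ z ≠ 0 → z ∈ closedBall (0 : E8) R₀ := fun z hz => by
    by_contra h
    exact hz (hρ0 z (by rwa [mem_closedBall_zero_iff, not_le] at h))
  set Lf : E8 → ℝ := Δ (newtonFar8 t) with hLf
  have hLfc : Continuous Lf := continuous_laplacian_newtonFar8 ht
  obtain ⟨KL, hKL⟩ := (hasCompactSupport_laplacian_newtonFar8 ht).exists_bound_of_continuous hLfc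
  have hLf0 : ∀ y, Lf y ≠ 0 → ‖y‖ ≤ 2 * t := fun y hy => by
    by_contra h
    exact hy (laplacian_newtonFar8_eq_zero_of_le ht (le_of_lt (not_le.1 h)))
  set B : E8 → ℝ := farPotential t ρ with hB
  have hBc : Continuous B := (contDiff_farPotential ht hρi hρ0 0).continuous
  -- a global bound for `B`
  set KB : ℝ := M * (1 + 2 / t) ^ 6 * (1 + R₀) ^ 6 * (volume : Measure E8).real (closedBall 0 R₀) with hKB
  have hKB0 : 0 ≤ KB := by positivity
  have hBb : ∀ x, |B x| ≤ KB := fun x => by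
    refine (abs_farPotential_le ht hρb hρ0 hR₀ x).trans ?_
    rw [← hKB]
    refine mul_le_of_le_one_right hKB0 ?_
    exact pow_le_one₀ (by positivity) (inv_le_one_of_one_le₀ (by linarith [norm_nonneg x]))
  have hfb : ∀ y, |newtonFar8 t y| ≤ 64 * (t ^ 6)⁻¹ := abs_newtonFar8_le_const ht
  -- Step 1: `Δv(x) B(x) = ∫ ρ(z) Lf(x - z) B(x) dz`, then swap `x ↔ z`
  have hstep1 : ∫ x, (Δ (farPotential t ρ)) x * B x = ∫ x, ∫ z, ρ z * Lf (x - z) * B x := by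
    refine integral_congr_ae (Eventually.of_forall fun x => ?_)
    simp only
    rw [laplacian_farPotential ht hρi hρ0 x, ← integral_mul_const]
  have hG1 : Integrable (uncurry fun x z => ρ z * Lf (x - z) * B x) (volume.prod volume) := by
    refine integrable_prod_of_bdd_support ?_ (K := M * KL * KB) (a := R₀ + 2 * t) (b := R₀) (fun p => ?_) (fun p hp => ?_)
    · exact ((hρi.aestronglyMeasurable.comp_snd).mul
        (hLfc.comp (continuous_fst.sub continuous_snd)).aestronglyMeasurable).mul
        (hBc.comp continuous_fst).aestronglyMeasurable
    · simp only [uncurry]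
      rw [abs_mul, abs_mul]
      refine mul_le_mul (mul_le_mul (hρb _) ((Real.norm_eq_abs _).symm.le.trans (hKL _)) (abs_nonneg _) hM)
        (hBb _) (abs_nonneg _) (mul_nonneg hM ((norm_nonneg _).trans (hKL 0)))
    · simp only [uncurry] at hp
      have hρz : ρ p.2 ≠ 0 := fun h => hp (by rw [h, zero_mul, zero_mul])
      have hL : Lf (p.1 - p.2) ≠ 0 := fun h => hp (by rw [h, mul_zero, zero_mul])
      refine ⟨mem_closedBall_zero_iff.2 ?_, hρR _ hρz⟩
      have h2 := hLf0 _ hL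
      have h3 := mem_closedBall_zero_iff.1 (hρR _ hρz)
      have h4 := norm_sub_norm_le p.1 p.2
      linarith
  rw [hstep1, integral_integral_swap hG1]
  -- Step 2: for fixed `z`, pull out `ρ z` and expand `B`
  refine integral_congr_ae (Eventually.of_forall fun z => ?_)
  simp only
  have hstep2 : ∫ x, ρ z * Lf (x - z) * B x = ρ z * ∫ x, Lf (x - z) * B x := by
    rw [← integral_const_mul]
    exact integral_congr_ae (Eventually.of_forall fun x => by ring)
  rw [hstep2]
  congr 1
  have hstep3 : ∫ x, Lf (x - z) * B x = ∫ x, ∫ w, Lf (x - z) * (ρ w * newtonFar8 t (x - w)) := by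
    refine integral_congr_ae (Eventually.of_forall fun x => ?_)
    simp only
    rw [hB, farPotential, ← integral_const_mul]
  have hG2 : Integrable (uncurry fun x w => Lf (x - z) * (ρ w * newtonFar8 t (x - w))) (volume.prod volume) := by
    refine integrable_prod_of_bdd_support ?_ (K := KL * (M * (64 * (t ^ 6)⁻¹))) (a := ‖z‖ + 2 * t) (b := R₀)
      (fun p => ?_) (fun p hp => ?_)
    · exact (hLfc.comp (continuous_fst.sub continuous_const)).aestronglyMeasurable.mul
        ((hρi.aestronglyMeasurable.comp_snd).mul
          ((contDiff_newtonFar8 ht (n := 0)).continuous.comp (continuous_fst.sub continuous_snd)).aestronglyMeasurable)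
    · simp only [uncurry]
      rw [abs_mul, abs_mul]
      refine mul_le_mul ((Real.norm_eq_abs _).symm.le.trans (hKL _))
        (mul_le_mul (hρb _) (hfb _) (abs_nonneg _) hM) (by positivity) ((norm_nonneg _).trans (hKL 0))
    · simp only [uncurry] at hp
      have hL : Lf (p.1 - z) ≠ 0 := fun h => hp (by rw [h, zero_mul])
      have hρw : ρ p.2 ≠ 0 := fun h => hp (by rw [h, zero_mul, mul_zero])
      refine ⟨mem_closedBall_zero_iff.2 ?_, hρR _ hρw⟩
      have h2 := hLf0 _ hL
      have h4 := norm_sub_norm_le p.1 z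
      linarith
  rw [hstep3, integral_integral_swap hG2]
  refine integral_congr_ae (Eventually.of_forall fun w => ?_)
  simp only
  rw [← integral_laplacian_sub_mul_sub t z w, ← integral_const_mul]
  exact integral_congr_ae (Eventually.of_forall fun x => by simp only; ring)


/-! ### Cauchy–Schwarz for the `L²` pairing -/

/-- **Cauchy–Schwarz**: `(∫ ⟪V, W⟫)² ≤ (∫ ‖V‖²)(∫ ‖W‖²)` for square-integrable fields on `ℝ⁸`. [folklore] -/
theorem sq_integral_inner_le {V W : E8 → E8} (hV : MemLp V 2 volume) (hW : MemLp W 2 volume) :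
    (∫ x, ⟪V x, W x⟫) ^ 2 ≤ (∫ x, ‖V x‖ ^ 2) * ∫ x, ‖W x‖ ^ 2 := by
  have hA : 0 ≤ ∫ x, ‖V x‖ ^ 2 := integral_nonneg fun _ => by positivity
  have hB : 0 ≤ ∫ x, ‖W x‖ ^ 2 := integral_nonneg fun _ => by positivity
  -- `|∫⟪V,W⟫| ≤ ∫ ‖V‖‖W‖`
  have h1 : |∫ x, ⟪V x, W x⟫| ≤ ∫ x, ‖V x‖ * ‖W x‖ := by
    rw [← Real.norm_eq_abs]
    exact norm_integral_le_of_norm_le (MemLp.integrable_mul hV.norm hW.norm)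
      (Eventually.of_forall fun x => by rw [Real.norm_eq_abs]; exact abs_real_inner_le_norm _ _)
  -- Hölder with `p = q = 2`
  have h2 : ∫ x, ‖V x‖ * ‖W x‖ ≤ (∫ x, ‖V x‖ ^ 2) ^ (1 / 2 : ℝ) * (∫ x, ‖W x‖ ^ 2) ^ (1 / 2 : ℝ) := by
    have hV' : MemLp (fun x => ‖V x‖) (ENNReal.ofReal 2) volume := by
      rw [show ENNReal.ofReal 2 = 2 by simp]; exact hV.norm
    have hW' : MemLp (fun x => ‖W x‖) (ENNReal.ofReal 2) volume := by
      rw [show ENNReal.ofReal 2 = 2 by simp]; exact hW.norm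
    have h := integral_mul_le_Lp_mul_Lq_of_nonneg Real.HolderConjugate.two_two
      (Eventually.of_forall fun x => norm_nonneg (V x)) (Eventually.of_forall fun x => norm_nonneg (W x)) hV' hW'
    simp only [Real.rpow_two] at h
    exact h
  have h0 : 0 ≤ ∫ x, ‖V x‖ * ‖W x‖ := integral_nonneg fun _ => by positivity
  calc (∫ x, ⟪V x, W x⟫) ^ 2 = |∫ x, ⟪V x, W x⟫| ^ 2 := (sq_abs _).symm
    _ ≤ (∫ x, ‖V x‖ * ‖W x‖) ^ 2 := pow_le_pow_left₀ (abs_nonneg _) h1 2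
    _ ≤ ((∫ x, ‖V x‖ ^ 2) ^ (1 / 2 : ℝ) * (∫ x, ‖W x‖ ^ 2) ^ (1 / 2 : ℝ)) ^ 2 := pow_le_pow_left₀ h0 h2 2
    _ = (∫ x, ‖V x‖ ^ 2) * ∫ x, ‖W x‖ ^ 2 := by
        rw [mul_pow, ← Real.rpow_natCast, ← Real.rpow_natCast, ← Real.rpow_mul hA, ← Real.rpow_mul hB]
        norm_num

/-! ### The inequality at fixed regularisation `t` -/

variable {t : ℝ} {ρ : E8 → ℝ} {M R₀ : ℝ} {F : E8 → E8}

/-- **Flux identity**: an `L²` field with weak divergence `ρ` satisfies `∫ ⟪F, ∇v_t⟫ = -∫ ρ v_t` against the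
regularised potential (cut-off removal; `ρ v_t ∈ L¹` since `v_t` is bounded). [cite: LiebLoss2001, Thm 7.7] -/
theorem integral_inner_gradient_farPotential (ht : 0 < t) (hρi : Integrable ρ) (hρb : ∀ z, |ρ z| ≤ M)
    (hρ0 : ∀ z, R₀ < ‖z‖ → ρ z = 0) (hR₀ : 0 ≤ R₀) (hF : MemLp F 2 volume)
    (hdiv : ∀ φ : E8 → ℝ, ContDiff ℝ 1 φ → HasCompactSupport φ →
      ∫ x, ⟪F x, gradient φ x⟫ = -∫ x, ρ x * φ x) :
    ∫ x, ⟪F x, gradient (farPotential t ρ) x⟫ = -∫ x, ρ x * farPotential t ρ x := by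
  refine integral_inner_gradient_eq_of_weakDiv hF ((contDiff_farPotential ht hρi hρ0 1))
    (memLp_farPotential ht hρi hρb hρ0 hR₀) (memLp_gradient_farPotential ht hρi hρb hρ0 hR₀) ?_ hdiv
  refine hρi.mul_bdd (contDiff_farPotential ht hρi hρ0 0).continuous.aestronglyMeasurable
    (c := M * (1 + 2 / t) ^ 6 * (1 + R₀) ^ 6 * (volume : Measure E8).real (closedBall 0 R₀))
    (Eventually.of_forall fun x => ?_)
  rw [Real.norm_eq_abs]
  refine (abs_farPotential_le ht hρb hρ0 hR₀ x).trans (mul_le_of_le_one_right (by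
    have hM : 0 ≤ M := (abs_nonneg _).trans (hρb 0); positivity) ?_)
  exact pow_le_one₀ (by positivity) (inv_le_one_of_one_le₀ (by linarith [norm_nonneg x]))

/-- **The regularised Thomson inequality**: `(∫ ρ v_t)² ≤ (∫‖F‖²) · (-∫ρ∫ρ m_t)`. [cite: LiebLoss2001, Thm 9.8] -/
theorem sq_integral_mul_farPotential_le (ht : 0 < t) (hρi : Integrable ρ) (hρb : ∀ z, |ρ z| ≤ M)
    (hρ0 : ∀ z, R₀ < ‖z‖ → ρ z = 0) (hR₀ : 0 ≤ R₀) (hF : MemLp F 2 volume)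
    (hdiv : ∀ φ : E8 → ℝ, ContDiff ℝ 1 φ → HasCompactSupport φ →
      ∫ x, ⟪F x, gradient φ x⟫ = -∫ x, ρ x * φ x) :
    (∫ x, ρ x * farPotential t ρ x) ^ 2 ≤
      (∫ x, ‖F x‖ ^ 2) * -∫ z, ρ z * ∫ w, ρ w * farSelfKernel t (z - w) := by
  have h1 := integral_inner_gradient_farPotential ht hρi hρb hρ0 hR₀ hF hdiv
  have h2 := sq_integral_inner_le hF (memLp_gradient_farPotential ht hρi hρb hρ0 hR₀)
  have h3 : ∫ x, ‖gradient (farPotential t ρ) x‖ ^ 2 = -∫ z, ρ z * ∫ w, ρ w * farSelfKernel t (z - w) := by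
    rw [← integral_laplacian_mul_farPotential ht hρi hρb hρ0 hR₀,
      ← integral_inner_gradient_farPotential_self ht hρi hρb hρ0 hR₀]
    exact integral_congr_ae (Eventually.of_forall fun x => (real_inner_self_eq_norm_sq _).symm)
  rw [h1, neg_sq] at h2
  rwa [h3] at h2

/-! ### The limit `t → 0` -/

/-- **Thomson's inequality in `ℝ⁸`.** For a bounded integrable density `ρ` vanishing off `B̄(0, R₀)` and an
`L²` field `F` with `∫⟪F, ∇φ⟫ = -∫ρφ` for all `φ ∈ C¹_c(ℝ⁸)`:
`∫ ρ(x) ∫ ρ(z) ‖x - z‖⁻⁶ dz dx ≤ 2π⁴ ∫ ‖F‖²`. [cite: LiebLoss2001, Thm 9.8] -/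
theorem coulomb_double_integral_le_of_weakDiv (hρi : Integrable ρ) (hρb : ∀ z, |ρ z| ≤ M)
    (hρ0 : ∀ z, R₀ < ‖z‖ → ρ z = 0) (hR₀ : 0 ≤ R₀) (hF : MemLp F 2 volume)
    (hdiv : ∀ φ : E8 → ℝ, ContDiff ℝ 1 φ → HasCompactSupport φ →
      ∫ x, ⟪F x, gradient φ x⟫ = -∫ x, ρ x * φ x) :
    ∫ x, ρ x * ∫ z, ρ z * ‖x - z‖⁻¹ ^ 6 ≤ 2 * Real.pi ^ 4 * ∫ x, ‖F x‖ ^ 2 := by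
  set S : ℝ := ∫ x, ρ x * ∫ z, ρ z * ‖x - z‖⁻¹ ^ 6 with hS
  set EF : ℝ := ∫ x, ‖F x‖ ^ 2 with hEF
  have hEF0 : 0 ≤ EF := integral_nonneg fun _ => by positivity
  -- the regularisation scales `tₙ = 1/(n+1)`
  set τ : ℕ → ℝ := fun n => 1 / ((n : ℝ) + 1) with hτ
  have hτpos : ∀ n, 0 < τ n := fun n => by rw [hτ]; positivity
  have hτlim : Tendsto τ atTop (𝓝 0) := tendsto_one_div_add_atTop_nhds_zero_nat
  have hev : ∀ {c : ℝ}, 0 < c → ∀ y : E8, y ≠ 0 → ∀ᶠ n in atTop, c * τ n ≤ ‖y‖ := fun {c} hc y hy => by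
    have hy0 : 0 < ‖y‖ := norm_pos_iff.2 hy
    have h := (hτlim.const_mul c)
    rw [mul_zero] at h
    exact (h.eventually (Iic_mem_nhds hy0)).mono fun n hn => hn
  -- left-hand sides: `∫ρ v_{tₙ} → S`
  have hL : Tendsto (fun n => ∫ x, ρ x * farPotential (τ n) ρ x) atTop (𝓝 S) := by
    have h := tendsto_integral_integral_kernel hρi hρb hρ0 hR₀ (κ := fun n => newtonFar8 (τ n)) (C := 1) (c := 1)
      zero_le_one (fun n => (contDiff_newtonFar8 (hτpos n) (n := 0)).continuous)
      (fun n y _ => by rw [one_mul]; exact abs_newtonFar8_le _ _)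
      (fun y hy => (hev one_pos y hy).mono fun n hn => by
        rw [one_mul] at hn ⊢; exact newtonFar8_eq_of_le (hτpos n) hn)
    rw [one_mul] at h
    exact h
  -- right-hand sides: `-∫ρ∫ρ m_{tₙ} → 2π⁴ S`
  have hR : Tendsto (fun n => -∫ z, ρ z * ∫ w, ρ w * farSelfKernel (τ n) (z - w)) atTop
      (𝓝 (2 * Real.pi ^ 4 * S)) := by
    have h := tendsto_integral_integral_kernel hρi hρb hρ0 hR₀ (κ := fun n y => -farSelfKernel (τ n) y)
      (C := max (2 * Real.pi ^ 4) (46656 * ∫ z, |(Δ (newtonFar8 1)) z|)) (c := 2 * Real.pi ^ 4)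
      farSelfKernel_const_nonneg (fun n => (continuous_farSelfKernel (hτpos n)).neg)
      (fun n y hy => by rw [abs_neg]; exact abs_farSelfKernel_le_kernel (hτpos n) hy)
      (fun y hy => (hev (by norm_num : (0 : ℝ) < 3) y hy).mono fun n hn => by
        rw [farSelfKernel_eq_of_le (hτpos n) hn]; ring)
    refine h.congr fun n => ?_
    rw [← integral_neg]
    refine integral_congr_ae (Eventually.of_forall fun z => ?_)
    simp only
    rw [← mul_neg, ← integral_neg]
    congr 1
    exact integral_congr_ae (Eventually.of_forall fun w => by simp only; ring)
  -- the inequality at each `n`, and its limit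
  have hineq : ∀ n, (∫ x, ρ x * farPotential (τ n) ρ x) ^ 2 ≤
      EF * -∫ z, ρ z * ∫ w, ρ w * farSelfKernel (τ n) (z - w) := fun n =>
    sq_integral_mul_farPotential_le (hτpos n) hρi hρb hρ0 hR₀ hF hdiv
  have hlim : S ^ 2 ≤ EF * (2 * Real.pi ^ 4 * S) :=
    le_of_tendsto_of_tendsto' (hL.pow 2) (hR.const_mul EF) hineq
  -- conclude
  by_cases hS0 : S ≤ 0
  · exact hS0.trans (by positivity)
  · have hSpos : 0 < S := lt_of_not_ge hS0
    have : S * S ≤ (2 * Real.pi ^ 4 * EF) * S := by nlinarith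
    exact le_of_mul_le_mul_right this hSpos

/-- **Registered sub-goal `thomson_inequality_E8`** (line `flux-cell-joint-census`, support of
`stub_confinedThomson`): Thomson's inequality in `ℝ⁸`, binder form of `coulomb_double_integral_le_of_weakDiv`.
[cite: LiebLoss2001, Thm 9.8] -/
theorem thomson_inequality_E8 : ∀ (ρ : E8 → ℝ) (M R₀ : ℝ) (F : E8 → E8),
    MeasureTheory.Integrable ρ MeasureTheory.volume → (∀ z, |ρ z| ≤ M) → (∀ z, R₀ < ‖z‖ → ρ z = 0) → 0 ≤ R₀ →
    MeasureTheory.MemLp F 2 MeasureTheory.volume →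
    (∀ φ : E8 → ℝ, ContDiff ℝ 1 φ → HasCompactSupport φ →
      ∫ x, inner ℝ (F x) (gradient φ x) = -∫ x, ρ x * φ x) →
    ∫ x, ρ x * ∫ z, ρ z * ‖x - z‖⁻¹ ^ 6 ≤ 2 * Real.pi ^ 4 * ∫ x, ‖F x‖ ^ 2 :=
  fun _ _ _ _ hρi hρb hρ0 hR₀ hF hdiv => coulomb_double_integral_le_of_weakDiv hρi hρb hρ0 hR₀ hF hdiv

end Summit.AtomisticToContinuum.Crystallization.Theorems.PricedLinkCensusLocalToGlobal

end
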